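import Summits.CriticalPhenomena.SAWScalingLimit.Theorems.SAWTotalPositivityBoundaryTP2Strip4OddBridge
import Summits.CriticalPhenomena.SAWScalingLimit.Theorems.SAWTotalPositivityBoundaryTP2Strip4OddBoxStep
import Summits.CriticalPhenomena.SAWScalingLimit.Theorems.SAWTotalPositivityBoundaryTP2Strip4OddBoxBase03
import Summits.CriticalPhenomena.SAWScalingLimit.Theorems.SAWTotalPositivityBoundaryTP2Strip4OddBoxBase12
import Summits.CriticalPhenomena.SAWScalingLimit.Theorems.SAWTotalPositivityBoundaryTP2RectFacingPairs
import Literature.Probability.RandomPlanarGeometry.SelfAvoidingWalkProofs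
import HarnessLib

/-!
# Crux `BoundaryTP2` (stmt-CriticalPhenomena-7115), line `Sketch`: the crux AS TYPED on the symmetric
facing quadruples of every 4-row strip (lead c6, width-4 corner assembly)

From the signed odd sector of the width-4 transfer (`strip4_oddSector_exists`), its single-column
initial values inside the box cone at `L₀ = 2` (`stub_strip4_oddBoxBase03/12`) and the invariance of the
box (`stub_strip4_oddBoxStep`) on the enclosure `x ∈ [1/3, 5/13]` of `x_c`, the odd coordinates
`a_n, b_n` are non-negative for every `n`; in kernel terms (`strip4_odd_signs`): on every strip
`S_n = {0..n} × {0..3}` and every `x ∈ [1/3, 5/13]`,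
`Z((0,j),(n,3-s)) ≤ Z((0,j),(n,s))` for `j, s ∈ {0,1}` — from a lower start row the lower of two
mirror-image targets wins.  These four inequalities are exactly the crux `BoundaryTP2` AS TYPED
(hypotheses and conclusion) for the vertically symmetric facing quadruples
`p₁ = (0,j₁), p₂ = (n,j₄), p₃ = (n,j₃), p₄ = (0,j₂)`, `j₁ + j₂ = 3 = j₃ + j₄`, of every 4-row strip
(`boundaryTP2_strip4_symm`, at `x_c`, given `x_c ≤ 5/13`).
-/

noncomputable section

namespace Summit.CriticalPhenomena.SAWScalingLimit.Theorems.BoundaryTP2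

open Literature.Probability.LatticeModels Literature.Probability.RandomPlanarGeometry
open Summit.CriticalPhenomena.SAWScalingLimit.Theorems.EdgeOfPositivity.Negative
open scoped ENNReal

/-! ## Signs of the odd sector -/

/-- Bernstein-type non-negative products on `[1/3, 5/13]`. [folklore] -/
private theorem s4c_bern {x : ℝ} (hx1 : 1 / 3 ≤ x) (hx2 : x ≤ 5 / 13) (i j : ℕ) :
    0 ≤ (x - 1 / 3) ^ i * (5 / 13 - x) ^ j :=
  mul_nonneg (pow_nonneg (by linarith) _) (pow_nonneg (by linarith) _)

/-- The first two signed odd coordinates are non-negative at `n = 0, 1` (explicit polynomials). [folklore] -/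
private theorem s4c_small {x : ℝ} (hx1 : 1 / 3 ≤ x) (hx2 : x ≤ 5 / 13) (r₁ : ℤ) (a b p q r t : ℕ → ℝ)
    (h0 : (r₁ = 0 → a 0 = 1 - x ^ 3 ∧ b 0 = x - x ^ 2 ∧ p 0 = x ^ 2 ∧ q 0 = x ∧ r 0 = x ^ 2 ∧ t 0 = x) ∧
       (r₁ = 1 → a 0 = x - x ^ 2 ∧ b 0 = 1 - x ∧ p 0 = x ∧ q 0 = x ^ 2 ∧ r 0 = 0 ∧ t 0 = 0))
    (hr : r₁ = 0 ∨ r₁ = 1)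
    (ha1 : a 1 = (x - x ^ 4) * a 0 + (x ^ 2 - x ^ 3) * b 0 - x ^ 4 * p 0 - x ^ 5 * q 0 - x ^ 4 * r 0 -
      x ^ 5 * t 0)
    (hb1 : b 1 = (x ^ 2 - x ^ 3) * a 0 + (x - x ^ 2) * b 0 - x ^ 5 * r 0 - x ^ 4 * t 0) :
    (0 ≤ a 0 ∧ 0 ≤ b 0) ∧ (0 ≤ a 1 ∧ 0 ≤ b 1) := by
  have B := s4c_bern hx1 hx2
  rcases hr with h | h
  · obtain ⟨ea, eb, ep, eq, er, et⟩ := h0.1 h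
    rw [ha1, hb1, ea, eb, ep, eq, er, et]
    refine ⟨⟨?_, ?_⟩, ?_, ?_⟩
    · linarith [B 0 3, B 1 2, B 2 1, B 3 0]
    · linarith [B 0 2, B 1 1, B 2 0]
    · linarith [B 0 7, B 1 6, B 2 5, B 3 4, B 4 3, B 5 2, B 6 1, B 7 0]
    · linarith [B 0 7, B 1 6, B 2 5, B 3 4, B 4 3, B 5 2, B 6 1, B 7 0]
  · obtain ⟨ea, eb, ep, eq, er, et⟩ := h0.2 h
    rw [ha1, hb1, ea, eb, ep, eq, er, et]
    refine ⟨⟨?_, ?_⟩, ?_, ?_⟩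
    · linarith [B 0 2, B 1 1, B 2 0]
    · linarith
    · linarith [B 0 7, B 1 6, B 2 5, B 3 4, B 4 3, B 5 2, B 6 1, B 7 0]
    · linarith [B 0 7, B 1 6, B 2 5, B 3 4, B 4 3, B 5 2, B 6 1, B 7 0]

/-- **Non-negativity of the signed odd coordinates `a_n`, `b_n` for all `n`** on `[1/3, 5/13]`: `n = 0, 1`
explicitly, `n ≥ 2` by the invariant box cone (`stub_strip4_oddBoxBase03/12`, `stub_strip4_oddBoxStep`). [folklore] -/
theorem strip4_odd_ab_nonneg {x : ℝ} (hx1 : 1 / 3 ≤ x) (hx2 : x ≤ 5 / 13) (r₁ : ℤ) (hr : r₁ = 0 ∨ r₁ = 1)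
    (a b p q r t : ℕ → ℝ)
    (h0 : (r₁ = 0 → a 0 = 1 - x ^ 3 ∧ b 0 = x - x ^ 2 ∧ p 0 = x ^ 2 ∧ q 0 = x ∧ r 0 = x ^ 2 ∧ t 0 = x) ∧
       (r₁ = 1 → a 0 = x - x ^ 2 ∧ b 0 = 1 - x ∧ p 0 = x ∧ q 0 = x ^ 2 ∧ r 0 = 0 ∧ t 0 = 0))
    (hrec : ∀ L, a (L + 1) = (x - x ^ 4) * a L + (x ^ 2 - x ^ 3) * b L - x ^ 4 * p L - x ^ 5 * q L -
          x ^ 4 * r L - x ^ 5 * t L ∧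
        b (L + 1) = (x ^ 2 - x ^ 3) * a L + (x - x ^ 2) * b L - x ^ 5 * r L - x ^ 4 * t L ∧
        p (L + 1) = x ^ 3 * a L + x ^ 2 * b L + x ^ 3 * p L + x ^ 4 * q L ∧
        q (L + 1) = x ^ 2 * a L + x ^ 3 * b L + x ^ 4 * p L + x ^ 3 * q L + x ^ 4 * r L ∧
        r (L + 1) = x ^ 3 * a L + x ^ 4 * q L + x ^ 3 * r L + x ^ 4 * t L ∧
        t (L + 1) = x ^ 2 * a L + x ^ 4 * r L + x ^ 3 * t L) (n : ℕ) :
    0 ≤ a n ∧ 0 ≤ b n := by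
  -- the box cone from `L₀ = 2` on
  have hbox : ∀ m, 2 ≤ m →
      0 ≤ a m ∧ 183 / 500 * a m ≤ b m ∧ b m ≤ 1081 / 1000 * a m ∧ 39 / 200 * a m ≤ p m ∧
        p m ≤ 819 / 1000 * a m ∧ 361 / 1000 * a m ≤ q m ∧ q m ≤ 143 / 200 * a m ∧ 17 / 500 * a m ≤ r m ∧
        r m ≤ 151 / 500 * a m ∧ 51 / 250 * a m ≤ t m ∧ t m ≤ 271 / 500 * a m := by
    intro m hm
    induction m, hm using Nat.le_induction with
    | base =>
      rcases hr with h | h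
      · exact stub_strip4_oddBoxBase03 hx1 hx2 a b p q r t (h0.1 h) hrec
      · exact stub_strip4_oddBoxBase12 hx1 hx2 a b p q r t (h0.2 h) hrec
    | succ m _ ih =>
      obtain ⟨ha, hb1, hb2, hp1, hp2, hq1, hq2, hr1, hr2, ht1, ht2⟩ := ih
      obtain ⟨ea, eb, ep, eq, er, et⟩ := hrec m
      rw [ea, eb, ep, eq, er, et]
      exact stub_strip4_oddBoxStep hx1 hx2 _ _ _ _ _ _ ha hb1 hb2 hp1 hp2 hq1 hq2 hr1 hr2 ht1 ht2
  rcases Nat.lt_or_ge n 2 with hn | hn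
  · have ha1 := (hrec 0).1
    have hb1 := (hrec 0).2.1
    rw [zero_add] at ha1 hb1
    obtain ⟨h0', h1'⟩ := s4c_small hx1 hx2 r₁ a b p q r t h0 hr ha1 hb1
    interval_cases n
    · exact h0'
    · exact h1'
  · obtain ⟨ha, hb, -⟩ := hbox n hn
    exact ⟨ha, by linarith⟩

/-- **Signs of the width-4 odd sector, in kernel form.** On every strip `S_n = {0..n} × {0..3}` and every
`x ∈ [1/3, 5/13]`: `Z((0,j),(n,3-s)) ≤ Z((0,j),(n,s))` for `j, s ∈ {0,1}`, i.e.
`Z((0,0),(n,3)) ≤ Z((0,0),(n,0))`, `Z((0,0),(n,2)) ≤ Z((0,0),(n,1))`, `Z((0,1),(n,3)) ≤ Z((0,1),(n,0))`,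
`Z((0,1),(n,2)) ≤ Z((0,1),(n,1))` (all lengths `n`, by the invariant box cone of the odd sector). [folklore] -/
theorem strip4_odd_signs (n : ℕ) {x : ℝ} (hx1 : 1 / 3 ≤ x) (hx2 : x ≤ 5 / 13) :
    pathKernel (discreteDomainGraph (rectDomain n 3) 1) x (st 0 0) (st n 3) ≤
        pathKernel (discreteDomainGraph (rectDomain n 3) 1) x (st 0 0) (st n 0) ∧
      pathKernel (discreteDomainGraph (rectDomain n 3) 1) x (st 0 0) (st n 2) ≤
        pathKernel (discreteDomainGraph (rectDomain n 3) 1) x (st 0 0) (st n 1) ∧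
      pathKernel (discreteDomainGraph (rectDomain n 3) 1) x (st 0 1) (st n 3) ≤
        pathKernel (discreteDomainGraph (rectDomain n 3) 1) x (st 0 1) (st n 0) ∧
      pathKernel (discreteDomainGraph (rectDomain n 3) 1) x (st 0 1) (st n 2) ≤
        pathKernel (discreteDomainGraph (rectDomain n 3) 1) x (st 0 1) (st n 1) := by
  have hx0 : 0 ≤ x := by linarith
  -- from the start-row pair `(0,3)`
  obtain ⟨a, b, p, q, r, t, h0, hrec, hdict⟩ := strip4_oddSector_exists hx0 0 3 (Or.inl ⟨rfl, rfl⟩)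
  obtain ⟨ha, hb⟩ := strip4_odd_ab_nonneg hx1 hx2 0 (Or.inl rfl) a b p q r t h0 hrec n
  obtain ⟨hda, hdb⟩ := hdict n
  -- from the start-row pair `(1,2)`
  obtain ⟨a', b', p', q', r', t', h0', hrec', hdict'⟩ := strip4_oddSector_exists hx0 1 2 (Or.inr ⟨rfl, rfl⟩)
  obtain ⟨ha', hb'⟩ := strip4_odd_ab_nonneg hx1 hx2 1 (Or.inr rfl) a' b' p' q' r' t' h0' hrec' n
  obtain ⟨hda', hdb'⟩ := hdict' n
  have fin := strip4_ne_top n x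
  have R30 := (stub_rect_reflect n 3 x 0 3 n 0).2
  have R31 := (stub_rect_reflect n 3 x 0 3 n 1).2
  have R20 := (stub_rect_reflect n 3 x 0 2 n 0).2
  have R21 := (stub_rect_reflect n 3 x 0 2 n 1).2
  norm_num at R30 R31 R20 R21
  refine ⟨?_, ?_, ?_, ?_⟩
  · rw [← R30]
    exact (ENNReal.toReal_le_toReal (fin _ _) (fin _ _)).1 (by linarith)
  · rw [← R31]
    exact (ENNReal.toReal_le_toReal (fin _ _) (fin _ _)).1 (by linarith)
  · rw [← R20]
    exact (ENNReal.toReal_le_toReal (fin _ _) (fin _ _)).1 (by linarith)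
  · rw [← R21]
    exact (ENNReal.toReal_le_toReal (fin _ _) (fin _ _)).1 (by linarith)

/-! ## The crux as typed on the symmetric facing quadruples of the 4-row strips -/

/-- **The crux `BoundaryTP2` AS TYPED on every 4-row strip, vertically symmetric facing quadruples.**
For `Ω = rectDomain n 3` (`n ≥ 1`), `δ = 1`, `(j₁, j₂) ∈ {(3,0), (2,1)}`, `(j₃, j₄) ∈ {(0,3), (1,2)}` and
`p₁ = (0,j₁)`, `p₂ = (n,j₄)`, `p₃ = (n,j₃)`, `p₄ = (0,j₂)`: the three hypotheses of the crux hold as typed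
(interlacing; `(p₁p₂|p₃p₄)` and `(p₁p₄|p₂p₃)` disjointly realisable) AND its conclusion
`Z(p₁,p₃)Z(p₂,p₄) ≤ Z(p₁,p₂)Z(p₃,p₄)` holds at `x_c`, given `x_c ≤ 5/13`
(`criticalFugacity_le_five_thirteenths_of_LSW`; unconditionally `SAW.le_connectiveConstant_26`).
The case `(3,0,0,3)` is the FOUR CORNERS of the strip. [folklore] -/
theorem boundaryTP2_strip4_symm (hxc : SAW.criticalFugacity ≤ 5 / 13) (n : ℕ) (hn : 1 ≤ n) {j₁ j₂ j₃ j₄ : ℤ}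
    (h₁₂ : (j₁ = 3 ∧ j₂ = 0) ∨ (j₁ = 2 ∧ j₂ = 1)) (h₃₄ : (j₃ = 0 ∧ j₄ = 3) ∨ (j₃ = 1 ∧ j₄ = 2)) :
    (∀ (P : SAW.DomainSAW (rectDomain n 3) 1 (st 0 j₁) (st n j₃))
        (Q : SAW.DomainSAW (rectDomain n 3) 1 (st n j₄) (st 0 j₂)),
        ∃ v, v ∈ P.walk.support ∧ v ∈ Q.walk.support) ∧
    (∃ (P : SAW.DomainSAW (rectDomain n 3) 1 (st 0 j₁) (st n j₄))
        (Q : SAW.DomainSAW (rectDomain n 3) 1 (st n j₃) (st 0 j₂)),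
        List.Disjoint P.walk.support Q.walk.support) ∧
    (∃ (P : SAW.DomainSAW (rectDomain n 3) 1 (st 0 j₁) (st 0 j₂))
        (Q : SAW.DomainSAW (rectDomain n 3) 1 (st n j₄) (st n j₃)),
        List.Disjoint P.walk.support Q.walk.support) ∧
    SAW.weight (rectDomain n 3) 1 (st 0 j₁) (st n j₃) Set.univ *
        SAW.weight (rectDomain n 3) 1 (st n j₄) (st 0 j₂) Set.univ ≤
      SAW.weight (rectDomain n 3) 1 (st 0 j₁) (st n j₄) Set.univ *
        SAW.weight (rectDomain n 3) 1 (st n j₃) (st 0 j₂) Set.univ := by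
  have h₂ : 0 ≤ j₂ := by rcases h₁₂ with ⟨-, rfl⟩ | ⟨-, rfl⟩ <;> norm_num
  have h₂₁ : j₂ < j₁ := by rcases h₁₂ with ⟨rfl, rfl⟩ | ⟨rfl, rfl⟩ <;> norm_num
  have h₁ : j₁ ≤ 3 := by rcases h₁₂ with ⟨rfl, -⟩ | ⟨rfl, -⟩ <;> norm_num
  have h₃ : 0 ≤ j₃ := by rcases h₃₄ with ⟨rfl, -⟩ | ⟨rfl, -⟩ <;> norm_num
  have h₃₄' : j₃ < j₄ := by rcases h₃₄ with ⟨rfl, rfl⟩ | ⟨rfl, rfl⟩ <;> norm_num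
  have h₄ : j₄ ≤ 3 := by rcases h₃₄ with ⟨-, rfl⟩ | ⟨-, rfl⟩ <;> norm_num
  obtain ⟨hI, hD₁, hD₂⟩ := stub_rect_facingPairs n 3 hn h₂ h₂₁ h₁ h₃ h₃₄' h₄
  have hI' := hI.reverse_right
  have hD₁' := hD₂.reverse_right
  have hD₂' := hD₁.reverse_right
  refine ⟨fun P Q => hI' ⟨P.walk, P.isPath⟩ ⟨Q.walk, Q.isPath⟩, ?_, ?_, ?_⟩
  · obtain ⟨P, Q, hPQ⟩ := hD₁'
    exact ⟨⟨P.1, P.2⟩, ⟨Q.1, Q.2⟩, by simpa using hPQ⟩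
  · obtain ⟨P, Q, hPQ⟩ := hD₂'
    exact ⟨⟨P.1, P.2⟩, ⟨Q.1, Q.2⟩, by simpa using hPQ⟩
  · simp only [weight_univ_eq_pathKernel]
    obtain ⟨s00, s01, s10, s11⟩ := strip4_odd_signs n SAW.one_third_le_criticalFugacity hxc
    have R30 := (stub_rect_reflect n 3 SAW.criticalFugacity 0 3 n 0).2
    have R31 := (stub_rect_reflect n 3 SAW.criticalFugacity 0 3 n 1).2
    have R32 := (stub_rect_reflect n 3 SAW.criticalFugacity 0 3 n 2).2
    have R33 := (stub_rect_reflect n 3 SAW.criticalFugacity 0 3 n 3).2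
    have R20 := (stub_rect_reflect n 3 SAW.criticalFugacity 0 2 n 0).2
    have R21 := (stub_rect_reflect n 3 SAW.criticalFugacity 0 2 n 1).2
    have R22 := (stub_rect_reflect n 3 SAW.criticalFugacity 0 2 n 2).2
    have R23 := (stub_rect_reflect n 3 SAW.criticalFugacity 0 2 n 3).2
    norm_num at R30 R31 R32 R33 R20 R21 R22 R23
    rcases h₁₂ with ⟨rfl, rfl⟩ | ⟨rfl, rfl⟩ <;> rcases h₃₄ with ⟨rfl, rfl⟩ | ⟨rfl, rfl⟩
    · rw [pathKernel_comm _ _ (st n 3) (st 0 0), pathKernel_comm _ _ (st n 0) (st 0 0), R30, R33]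
      exact mul_le_mul' s00 s00
    · rw [pathKernel_comm _ _ (st n 2) (st 0 0), pathKernel_comm _ _ (st n 1) (st 0 0), R31, R32]
      exact mul_le_mul' s01 s01
    · rw [pathKernel_comm _ _ (st n 3) (st 0 1), pathKernel_comm _ _ (st n 0) (st 0 1), R20, R23]
      exact mul_le_mul' s10 s10
    · rw [pathKernel_comm _ _ (st n 2) (st 0 1), pathKernel_comm _ _ (st n 1) (st 0 1), R21, R22]
      exact mul_le_mul' s11 s11

end Summit.CriticalPhenomena.SAWScalingLimit.Theorems.BoundaryTP2
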